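import Literature.Computability.QuantumComplexity.HadamardGadgetProg
import HarnessLib

/-!
# Uniformity of the Hadamard-gadget family, IV: the gate loop of the machine

Topic `Literature/Computability/QuantumComplexity`; fourth of the files proving that the compiled
post-selected IQP family `HGadget.Hop.gadgetFamily F` is uniform (Bremner–Jozsa–Shepherd 2011,
proof of Thm. 1 with Def. 1). The token handlers of `HadamardGadgetProg.lean` are dispatched on the
three bits of a token (`handler`, `disp2`, `disp1`, `gateLoop`, as in `ForrelationThm25Asm.lean`),
the loop is modelled by `loopM`, and **`runs_gateLoop`** proves that from every state satisfying
the invariant `Inv` the loop runs to its model within `|g| · (handlerCost + 6) + 7` steps. The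
invariant bounds the accumulator and the slots by a potential decreasing with the stream, and the
stage counter by the number of tokens still to come.

## References

* M. J. Bremner, R. Jozsa, D. J. Shepherd, Proc. R. Soc. A 467 (2011) 459–472, Def. 1, Thm. 1.
* S. Arora, B. Barak, *Computational Complexity: A Modern Approach*, CUP 2009, §1.3, §6.1.
-/

namespace Literature.Computability.QuantumComplexity

open _root_.Computability Complexity Complexity.Com Cryptography Thm25Lex
open Thm25Asm (IsFlag isFlag_nil isFlag_true isFlag_flag)

namespace HGadget.Hop

namespace Asm

variable {L N K : ℕ}

/-! ### Dispatch -/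

/-- The handler of the token `a b d`. [folklore] -/
def handler : Bool → Bool → Bool → Com R
  | false, false, d => hBit d
  | false, true, false => hSEP
  | false, true, true => cleanup
  | true, false, false => hH
  | true, false, true => hS
  | true, true, false => hT
  | true, true, true => hCNOT

/-- Dispatch on the third bit. [folklore] -/
def disp2 (a b : Bool) : Com R := Com.pop .g (handler a b true) (handler a b false) Com.skip
/-- Dispatch on the second bit. [folklore] -/
def disp1 (a : Bool) : Com R := Com.pop .g (disp2 a true) (disp2 a false) Com.skip
/-- **The gate loop**: pop tokens of three bits and dispatch. [folklore] -/
def gateLoop : Com R := Com.loop .g (disp1 true) (disp1 false)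

/-- Model of the handler of the token `a b d`. [folklore] -/
def actM (L N : ℕ) : Bool → Bool → Bool → St → St
  | false, false, d => hBitM d
  | false, true, false => hSEPM L
  | false, true, true => cleanupM L
  | true, false, false => hHM L N
  | true, false, true => hSM L N
  | true, true, false => hTM L N
  | true, true, true => hCNOTM L N

/-- Model of the gate loop (an incomplete trailing token is discarded). [folklore] -/
def loopM (L N : ℕ) : List Bool → St → St
  | a :: b :: d :: z, s => loopM L N z (actM L N a b d { s with g := z })
  | _, s => { s with g := [] }

/-- `loopM` on the empty stream. [folklore] -/
theorem loopM_nil (s : St) : loopM L N [] s = { s with g := [] } := rfl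
/-- `loopM` on one bit. [folklore] -/
theorem loopM_one (a : Bool) (s : St) : loopM L N [a] s = { s with g := [] } := rfl
/-- `loopM` on two bits. [folklore] -/
theorem loopM_two (a b : Bool) (s : St) : loopM L N [a, b] s = { s with g := [] } := rfl
/-- `loopM` on a token. [folklore] -/
theorem loopM_cons₃ (a b d : Bool) (z : List Bool) (s : St) :
    loopM L N (a :: b :: d :: z) s = loopM L N z (actM L N a b d { s with g := z }) := rfl

/-- `commitM` does not touch the stream. [folklore] -/
theorem commitM_g (s : St) : (commitM s).g = s.g := by unfold commitM; split_ifs <;> rfl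

/-- The handlers do not touch the stream register. [folklore] -/
theorem actM_g (a b d : Bool) (s : St) : (actM L N a b d s).g = s.g := by
  cases a <;> cases b <;> cases d <;> first | rfl | exact commitM_g _

/-! ### The invariant -/

/-- The invariant of the gate loop: the environment, the slot flag, the countdown of ticks, the
stage numerals with room for the tokens still to come, the counter, and the potential bounding the
accumulator and the slots. [folklore] -/
structure Inv (L N K : ℕ) (s : St) : Prop where
  /-- environment -/
  hE : Env L N s
  /-- slot flag -/
  hf : IsFlag s.f1
  /-- the countdown holds at most `L` ticks -/
  hlc : ∃ j, j ≤ L ∧ s.lc = List.replicate j true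
  /-- stage numerals, with room -/
  hst : ∃ c, Stages c s ∧ c + 2 * s.g.length + 13 ≤ K
  /-- counter -/
  hiF : s.iF.length ≤ L
  /-- countdown of the hop loops -/
  hcU : s.cU = []
  /-- potential -/
  hw : s.wa.length + s.w1.length + s.w2.length + (L + 1) * s.g.length ≤ K

/-- The hypotheses of the kind handlers follow from the invariant. [folklore] -/
theorem Inv.kindPre {s : St} (hI : Inv L N K s) : ∃ c, KindPre L N K c s ∧ c + 13 ≤ K := by
  obtain ⟨c, hst, hc⟩ := hI.hst
  obtain ⟨j, hj, hlc⟩ := hI.hlc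
  have hw := hI.hw
  have hl : (encodeNat c).length ≤ c := TokConv.length_encodeNat_le c
  have h1 : (encodeNat (c + 1)).length ≤ c + 1 := TokConv.length_encodeNat_le _
  have h2 : (encodeNat (c + 2)).length ≤ c + 2 := TokConv.length_encodeNat_le _
  refine ⟨c, ⟨hI.hE, ⟨hI.hiF, hI.hcU, by omega, by omega, ?_, ?_, ?_⟩, hst, hI.hf, by rw [hlc]; simpa using hj, by omega, by omega⟩,
    by omega⟩
  · rw [hst.hsB]; omega
  · rw [hst.hs1]; omega
  · rw [hst.hs2]; omega

/-- **Every handler runs from a state satisfying the invariant to its model within `handlerCost`.**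
[folklore] -/
theorem runs_handler (a b d : Bool) (s : St) (hI : Inv L N K s) :
    Runs (handler a b d) s.regs (actM L N a b d s).regs (handlerCost L N K) := by
  obtain ⟨c, hP, hc⟩ := hI.kindPre
  obtain ⟨j, hj, hlc⟩ := hI.hlc
  have hw := hI.hw
  have hB : 30 * L ≤ blockCost L N K := by unfold blockCost hopCost; omega
  have hC : 16 * L + 3 * K + 20 ≤ handlerCost L N K := by unfold handlerCost; omega
  cases a <;> cases b <;> cases d
  · exact (runs_hBit false s j hlc).of_eq rfl (by omega)
  · exact (runs_hBit true s j hlc).of_eq rfl (by omega)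
  · refine (runs_hSEP s hI.hE hI.hf).of_eq rfl ?_
    rw [hlc, List.length_replicate]; omega
  · exact runs_hBAD s hP
  · exact runs_hH s hP
  · exact runs_hS s hP
  · exact runs_hT s hP
  · exact runs_hCNOT s hP hc

/-- The invariant survives shortening the stream. [folklore] -/
theorem Inv.of_g {s : St} (hI : Inv L N K s) {z : List Bool} (hz : z.length ≤ s.g.length) : Inv L N K { s with g := z } := by
  obtain ⟨hE, hf, hlc, ⟨c, hst, hc⟩, hiF, hcU, hw⟩ := hI
  have hm : (L + 1) * z.length ≤ (L + 1) * s.g.length := Nat.mul_le_mul_left _ hz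
  exact ⟨⟨hE.hLU, hE.hNU, hE.ht, hE.ht2, hE.hfl⟩, hf, hlc, ⟨c, ⟨hst.hsB, hst.hs1, hst.hs2⟩, by simp only; omega⟩, hiF, hcU,
    by simp only at hw ⊢; omega⟩

/-- Three bits fewer: the potential term. [folklore] -/
theorem mul_length_cons₃ (L : ℕ) (a b d : Bool) (z : List Bool) :
    (L + 1) * (a :: b :: d :: z).length = (L + 1) * z.length + 3 * L + 3 := by
  simp only [List.length_cons]; ring

/-- **The handlers preserve the invariant.** [folklore] -/
theorem inv_actM (a b d : Bool) (s : St) (z : List Bool) (hI : Inv L N K s) (hg : s.g = a :: b :: d :: z) :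
    Inv L N K (actM L N a b d { s with g := z }) := by
  obtain ⟨hE, hf, ⟨j, hj, hlc⟩, ⟨c, hst, hc⟩, hiF, hcU, hw⟩ := hI
  rw [hg, mul_length_cons₃] at hw
  rw [hg] at hc
  simp only [List.length_cons] at hc
  have hEnv : ∀ s' : St, s'.LU = s.LU → s'.NU = s.NU → s'.t = s.t → s'.t2 = s.t2 → s'.fl = s.fl → Env L N s' :=
    fun s' h1 h2 h3 h4 h5 => ⟨h1 ▸ hE.hLU, h2 ▸ hE.hNU, h3 ▸ hE.ht, h4 ▸ hE.ht2, h5 ▸ hE.hfl⟩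
  have hsB : decodeNat s.sB = c := by rw [hst.hsB, decode_encodeNat]
  cases a <;> cases b <;> cases d
  · -- bit 0
    refine ⟨hEnv _ rfl rfl rfl rfl rfl, hf, ⟨j - 1, by omega, ?_⟩, ⟨c, ⟨hst.hsB, hst.hs1, hst.hs2⟩, by simp only [actM, hBitM]; omega⟩,
      hiF, hcU, by simp only [actM, hBitM, List.length_cons]; omega⟩
    simp only [actM, hBitM, hlc]
    cases j <;> simp [List.replicate_succ]
  · -- bit 1
    refine ⟨hEnv _ rfl rfl rfl rfl rfl, hf, ⟨j - 1, by omega, ?_⟩, ⟨c, ⟨hst.hsB, hst.hs1, hst.hs2⟩, by simp only [actM, hBitM]; omega⟩,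
      hiF, hcU, by simp only [actM, hBitM, List.length_cons]; omega⟩
    simp only [actM, hBitM, hlc]
    cases j <;> simp [List.replicate_succ]
  · -- separator
    simp only [actM, hSEPM, commitM, padM]
    split_ifs with h
    · refine ⟨hEnv _ rfl rfl rfl rfl rfl, isFlag_true, ⟨L, le_rfl, rfl⟩, ⟨c, ⟨hst.hsB, hst.hs1, hst.hs2⟩, by simp only; omega⟩, hiF, hcU, ?_⟩
      simp only [List.length_nil, List.length_append, List.length_reverse, List.length_replicate, hlc]; omega
    · refine ⟨hEnv _ rfl rfl rfl rfl rfl, by simpa using hf, ⟨L, le_rfl, rfl⟩, ⟨c, ⟨hst.hsB, hst.hs1, hst.hs2⟩, by simp only; omega⟩,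
        hiF, hcU, ?_⟩
      simp only [List.length_nil, List.length_append, List.length_reverse, List.length_replicate, hlc]; omega
  · -- bad token
    exact ⟨hEnv _ rfl rfl rfl rfl rfl, isFlag_nil, ⟨L, le_rfl, rfl⟩, ⟨c, ⟨hst.hsB, hst.hs1, hst.hs2⟩, by simp only [actM, cleanupM]; omega⟩,
      hiF, hcU, by simp only [actM, cleanupM, List.length_nil]; omega⟩
  · -- H
    exact ⟨hEnv _ rfl rfl rfl rfl rfl, isFlag_nil, ⟨L, le_rfl, rfl⟩, ⟨c + 2, ⟨by simp [actM, hHM, stepM, advM, cleanupM, hsB],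
      by simp [actM, hHM, stepM, advM, cleanupM, hsB], by simp [actM, hHM, stepM, advM, cleanupM, hsB]⟩,
      by simp only [actM, hHM, stepM, advM, cleanupM]; omega⟩, by simp [actM, hHM, stepM, advM, cleanupM],
      rfl, by simp only [actM, hHM, stepM, advM, cleanupM, List.length_nil]; omega⟩
  · -- S
    exact ⟨hEnv _ rfl rfl rfl rfl rfl, isFlag_nil, ⟨L, le_rfl, rfl⟩, ⟨c + 2, ⟨by simp [actM, hSM, stepM, advM, cleanupM, hsB],
      by simp [actM, hSM, stepM, advM, cleanupM, hsB], by simp [actM, hSM, stepM, advM, cleanupM, hsB]⟩,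
      by simp only [actM, hSM, stepM, advM, cleanupM]; omega⟩, by simp [actM, hSM, stepM, advM, cleanupM],
      rfl, by simp only [actM, hSM, stepM, advM, cleanupM, List.length_nil]; omega⟩
  · -- T
    exact ⟨hEnv _ rfl rfl rfl rfl rfl, isFlag_nil, ⟨L, le_rfl, rfl⟩, ⟨c + 2, ⟨by simp [actM, hTM, stepM, advM, cleanupM, hsB],
      by simp [actM, hTM, stepM, advM, cleanupM, hsB], by simp [actM, hTM, stepM, advM, cleanupM, hsB]⟩,
      by simp only [actM, hTM, stepM, advM, cleanupM]; omega⟩, by simp [actM, hTM, stepM, advM, cleanupM],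
      rfl, by simp only [actM, hTM, stepM, advM, cleanupM, List.length_nil]; omega⟩
  · -- CNOT
    exact ⟨hEnv _ rfl rfl rfl rfl rfl, isFlag_nil, ⟨L, le_rfl, rfl⟩, ⟨c + 6, ⟨by simp [actM, hCNOTM, adv3M, cleanupM, hsB],
      by simp [actM, hCNOTM, adv3M, cleanupM, hsB], by simp [actM, hCNOTM, adv3M, cleanupM, hsB]⟩,
      by simp only [actM, hCNOTM, adv3M, cleanupM]; omega⟩, by simp [actM, hCNOTM, adv3M, cleanupM],
      rfl, by simp only [actM, hCNOTM, adv3M, cleanupM, List.length_nil]; omega⟩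

/-! ### The gate loop runs -/

/-- A state whose stream register already holds `z` is its own update. [folklore] -/
theorem St.with_g_eq (s : St) {z : List Bool} (h : s.g = z) : ({ s with g := z } : St) = s := by rw [← h]

/-- **The gate loop on an arbitrary stream**: from a state satisfying the invariant it runs to the
model `loopM` within `|g| (handlerCost + 6) + 7` steps. [folklore] -/
theorem runs_gateLoop : ∀ (z : List Bool) (s : St), Inv L N K s → s.g = z →
    Runs gateLoop s.regs (loopM L N z s).regs (z.length * (handlerCost L N K + 6) + 7)
  | [], s, _, hg => by
    refine (Runs.loop_nil (disp1 true) (disp1 false) (show s.regs R.g = [] from hg)).of_eq ?_ (by simp)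
    rw [loopM_nil, St.with_g_eq s hg]
  | [a], s, _, hg => by
    have h1 : Runs (disp1 a) { s with g := [] }.regs { s with g := [] }.regs 2 := (Runs.pop_nil _ _ rfl (Runs.skip _)).of_eq rfl (by omega)
    have h2 : Runs gateLoop { s with g := [] }.regs { s with g := [] }.regs 1 := Runs.loop_nil _ _ rfl
    have hk : s.regs R.g = a :: [] := hg
    cases a
    · exact (Runs.loop_false' hk (St.upd_g s _) h1 h2).of_eq (by rw [loopM_one]) (by simp)
    · exact (Runs.loop_true' hk (St.upd_g s _) h1 h2).of_eq (by rw [loopM_one]) (by simp)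
  | [a, b], s, _, hg => by
    have h0 : ∀ e : Bool, Runs (disp2 a e) { s with g := [] }.regs { s with g := [] }.regs 2 := fun e =>
      (Runs.pop_nil _ _ rfl (Runs.skip _)).of_eq rfl (by omega)
    have hk1 : ({ s with g := [b] } : St).regs R.g = b :: [] := rfl
    have h1 : Runs (disp1 a) { s with g := [b] }.regs { s with g := [] }.regs 4 := by
      cases b
      · exact (Runs.pop_false' _ _ hk1 (St.upd_g _ _) (h0 false)).of_eq rfl (by omega)
      · exact (Runs.pop_true' _ _ hk1 (St.upd_g _ _) (h0 true)).of_eq rfl (by omega)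
    have h2 : Runs gateLoop { s with g := [] }.regs { s with g := [] }.regs 1 := Runs.loop_nil _ _ rfl
    have hk : s.regs R.g = a :: [b] := hg
    cases a
    · exact (Runs.loop_false' hk (St.upd_g s _) h1 h2).of_eq (by rw [loopM_two]) (by simp)
    · exact (Runs.loop_true' hk (St.upd_g s _) h1 h2).of_eq (by rw [loopM_two]) (by simp)
  | a :: b :: d :: z, s, hI, hg => by
    have hI' : Inv L N K { s with g := z } := hI.of_g (by rw [hg]; simp only [List.length_cons]; omega)
    have hh := runs_handler a b d { s with g := z } hI'
    have hrec := runs_gateLoop z (actM L N a b d { s with g := z }) (inv_actM a b d s z hI hg) (by rw [actM_g])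
    have hk2 : ({ s with g := d :: z } : St).regs R.g = d :: z := rfl
    have h2 : Runs (disp2 a b) { s with g := d :: z }.regs (actM L N a b d { s with g := z }).regs (handlerCost L N K + 2) := by
      cases d
      · exact Runs.pop_false' _ _ hk2 (St.upd_g _ _) hh
      · exact Runs.pop_true' _ _ hk2 (St.upd_g _ _) hh
    have hk1 : ({ s with g := b :: d :: z } : St).regs R.g = b :: d :: z := rfl
    have h1 : Runs (disp1 a) { s with g := b :: d :: z }.regs (actM L N a b d { s with g := z }).regs (handlerCost L N K + 2 + 2) := by
      cases b
      · exact Runs.pop_false' _ _ hk1 (St.upd_g _ _) h2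
      · exact Runs.pop_true' _ _ hk1 (St.upd_g _ _) h2
    have hk : s.regs R.g = a :: b :: d :: z := hg
    have hX : (a :: b :: d :: z).length * (handlerCost L N K + 6) = z.length * (handlerCost L N K + 6) + 3 * (handlerCost L N K + 6) := by
      simp only [List.length_cons]; ring
    have hcost : handlerCost L N K + 2 + 2 + 2 + (z.length * (handlerCost L N K + 6) + 7) ≤
        (a :: b :: d :: z).length * (handlerCost L N K + 6) + 7 := by omega
    cases a
    · exact (Runs.loop_false' hk (St.upd_g s _) h1 hrec).of_eq (by rw [loopM_cons₃]) hcost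
    · exact (Runs.loop_true' hk (St.upd_g s _) h1 hrec).of_eq (by rw [loopM_cons₃]) hcost

end Asm

end HGadget.Hop

end Literature.Computability.QuantumComplexity
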